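import Summits.BirchSwinnertonDyer.BirchSwinnertonDyer.Theses.AdditiveKolyvaginRoad
import Summits.BirchSwinnertonDyer.BirchSwinnertonDyer.Theorems.TeichmullerTwistDescentCellsOfCDT
import Summits.BirchSwinnertonDyer.BirchSwinnertonDyer.Theorems.AdditiveKolyvaginRoadAssembly
import Summits.BirchSwinnertonDyer.BirchSwinnertonDyer.Theorems.AdditiveKolyvaginRoadAdditiveKolyvaginKernel
import Summits.BirchSwinnertonDyer.BirchSwinnertonDyer.Theorems.AdditiveKolyvaginRoadManinFrameTransport
import Summits.BirchSwinnertonDyer.BirchSwinnertonDyer.Theorems.AdditiveKolyvaginRoadManinFrameFromDatum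
import Summits.BirchSwinnertonDyer.Rank1Residual.X2.IsogenyClassStability
import Literature.NumberTheory.Automorphic.ShimuraCurveRibetTakahashiOptimalModularityProofs
import HarnessLib

/-!
# Route `AdditiveKolyvaginRoad`: the WHOLE Manin frame — `ManinGoodOddFrameAdditive` (20136), `ManinFrameResidueClass`
# (20094), `ManinFrameResidueProper` (20483), `ManinFrameResidueProperR` (20709) — and the rung W-ALL/2, MODULO THE
# PRINTED CALEGARI–DIMITROV–TANG UNBOUNDED-DENOMINATORS THEOREM (and the registered PUB bundle 20137) ONLY — `--supports`

Cell `pub/bsd-wall`, seat `bsd-line-ttd-p1` (prover 1/2 on the sibling line TeichmullerTwistDescent, g31; cross-route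
helper, announced on STATUS 2026-08-30T10:5xZ). THEOREMS ONLY (no definition, no named fact, no `sorry`); every theorem is
`proof.conditional` on ONE cite-only PRINTED fact, the vendored unbounded-denominators theorem
`Literature.NumberTheory.Automorphic.CalegariDimitrovTang2025_unboundedDenominators_algInt` (Calegari–Dimitrov–Tang, J. Amer.
Math. Soc. 38 (2025), Thm. 1, Remarks 58–59; «CDT»); nothing is closed by name; BSD is not proved; Manin's conjecture is not
proved unconditionally; no Manin theorem is announced (director-bsd (505)/(527): «closed modulo CDT; items open»).

WHAT THIS FILE DOES. The cell bsd-f2-manin's corollary of its PROVED `c`-division witness and CDT,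
`ManinLocalTwoThree.CDivisionUDC.abs_maninConstant_eq_one_of_CDT_of_odd_sq_dvd` (p755101), read at an additive prime `p ≥ 5`
(`TeichmullerTwistDescent.not_dvd_c_of_CDT`, p769544: `p ∤ c(D)` at EVERY lattice-optimal datum of EVERY globally minimal curve
additive at `p ≥ 5`, no `Irr`, no Kodaira clause), is combined with the road's own LANDED machinery:
modularity ⟹ an `X₀(N)`-optimal member `W₀ ∼ W` with a degree-minimal, hence lattice-optimal, datum at level `N(W)`
(`exists_optimal_modularParametrizationData_of_modularity`, `latticeEq_of_forall_modularDegree_le`); prime-to-`p` transport of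
`p ∤ c` to `W` under `E[p]` irreducible (`ManinFrameTransport.exists_modularParametrizationData_not_dvd_of_partner`); the
Hoffstein–Luo frame from a datum (`ManinFrameFromDatum.exists_oddHeegnerFrame_of_exists_not_dvd`). RESULT:

* `exists_datum_not_dvd_c_of_CDT` — **every globally minimal `W` additive at `p ≥ 5` with `E[p]` irreducible carries a
  conductor-level datum with `p ∤ c`, MODULO CDT and modularity** (the `∃ D, p ∤ c(D)` currency of KP57 / the frame).
* `maninGoodOddFrameAdditive_of_CDT` — **the frame crux `ManinGoodOddFrameAdditive` (20136) ⟸ CDT** (its own binder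
  `PublishedInputsAdditiveKoly` supplies modularity and Hoffstein–Luo). The road's ENTIRE gen-2 split of 20136 — Edixhoven's two
  readings (20323, 20089), Mazur (19383), Abbes–Ullmo (20090), Česnavičius at `2` (20091), the off-exception / `Iₙ*` class
  theorems (20092, 20093), the residue class (20094), the ČNS degree class (20481, 20482), the proper residue (20483 / R 20709),
  Dokchitser (20708) — is IDLE modulo CDT: `maninFrameResidueClass_of_CDT` (20094), `maninFrameResidueProper_of_CDT` (20483),
  `maninFrameResidueProperR_of_CDT` (20709) are the frame with their extra clauses unused.
* `wAllExclAdditive_of_koly_of_CDT` — **the rung `Summit.BirchSwinnertonDyer.WAllExclAdditive` (W-ALL/2) ⟸ CDT ∧ the four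
  Kolyvagin-side open cruxes `KolyvaginPrimitiveAdditive` (21400), `RankZeroAdditive` (20133), `OffSharpRankOneAdditive` (20134),
  `AdditiveAtThree` (20135) ∧ the hypothesis-only bundle `PublishedInputsAdditiveKoly` (20137)** — via the landed assembly (20139)
  and kernel (20138). Of the 17 hypotheses of the road's `closes`, the ten Manin ones leave the cone.

HONEST STATUS: CONDITIONAL on the printed CDT fact (vendored `Prop` = the cell bsd-f2-manin's trust base; audits (505)/(527)
pending); the items stay OPEN by name (their statements are unconditional); the road's live residual is the Kolyvagin side
{21400, 20133, 20134, 20135}. BSD is not proved by this; no W-ALL class theorem is proved by this; Manin's conjecture is not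
proved by this. [cite: CalegariDimitrovTang2025, Thm. 1 and Remarks 58–59] [cite: LingOesterle1991, Thm. 6]
[cite: HoffsteinLuo1997, Thm. (nonvanishing quadratic twists)] [cite: Knapp1993, Prop. 12.9(a) (degree-minimal ⟹ lattice-optimal)]
[cite: WZhang2014, Thm. 1.1 (shape of the Kolyvagin-side cruxes)]
-/

set_option autoImplicit false
-- single-conjunct summit: `Summit.BirchSwinnertonDyer.BirchSwinnertonDyer.…` repeats the name by design
set_option linter.dupNamespace false

noncomputable section

open scoped Classical

open WeierstrassCurve Literature.NumberTheory.EllipticCurves Literature.NumberTheory.EllipticCurves.ModularForms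
  Literature.NumberTheory.EllipticCurves.Rank1Residual
  Summit.BirchSwinnertonDyer.Rank1Residual
  Summit.BirchSwinnertonDyer.BirchSwinnertonDyer.Theses.AdditiveKolyvaginRoad
  Summit.BirchSwinnertonDyer.BirchSwinnertonDyer.Theorems

namespace Summit.BirchSwinnertonDyer.BirchSwinnertonDyer.Theorems.AdditiveKolyOfCDT

/-! ### §1 A conductor-level datum with `p ∤ c` for every member, modulo CDT and modularity -/

/-- **Every globally minimal `W/ℚ`, additive at a prime `p ≥ 5` with `E[p]` irreducible, carries a parametrisation datum at
its conductor level with `p ∤ c`, MODULO CDT and modularity.** Modularity gives an optimal member `W₀ ∼ W` with a degree-minimal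
datum `D₀` at level `N(W)`, which is lattice-optimal (Knapp 12.9(a)); `W₀` is additive at `p` (isogeny invariance); CDT gives
`p ∤ c(D₀)` (`TeichmullerTwistDescent.not_dvd_c_of_CDT`); prime-to-`p` transport along the class (`E[p]` irreducible) moves it
to `W`. CONDITIONAL on the cite-only printed facts `hCDT`, `hnf`; BSD and Manin's conjecture are not proved by this.
[cite: CalegariDimitrovTang2025, Thm. 1 and Remarks 58–59] [cite: Knapp1993, Prop. 12.9(a)] [cite: BCDTJAMS2001, Thm. A] -/
theorem exists_datum_not_dvd_c_of_CDT
    (hCDT : Literature.NumberTheory.Automorphic.CalegariDimitrovTang2025_unboundedDenominators_algInt)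
    (hnf : exists_isNewformOf)
    (W : WeierstrassCurve ℚ) [W.IsElliptic] [W.IsGloballyMinimal] (p : ℕ) [Fact p.Prime]
    [NeZero (W.conductorNorm ℤ)] (hp5 : 5 ≤ p) (hadd : Addv W p) (hirr : Irr W p) :
    ∃ Dt : ModularParametrizationData W (W.conductorNorm ℤ), ¬ (p : ℤ) ∣ Dt.c := by
  obtain ⟨W₀, hW₀, hW₀min, D₀, _hfW, hiso, hmin⟩ :=
    Literature.NumberTheory.Automorphic.exists_optimal_modularParametrizationData_of_modularity hnf
      (W.conductorNorm ℤ) W rfl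
  haveI := hW₀
  haveI := hW₀min
  have hlat : ∀ z ∈ D₀.L.lattice, ∃ w ∈ periodLattice D₀.f, z = D₀.c * w :=
    D₀.latticeEq_of_forall_modularDegree_le hmin
  have hadd₀ : Addv W₀ p := (X2.addv_iff_of_isIsogenous hiso).mp hadd
  have hc₀ : ¬ (p : ℤ) ∣ D₀.c := TeichmullerTwistDescent.not_dvd_c_of_CDT hCDT D₀ hp5 hadd₀ hlat
  exact ManinFrameTransport.exists_modularParametrizationData_not_dvd_of_partner W Fact.out hirr hiso D₀ hc₀

/-! ### §2 The frame crux and its whole split, BY NAME, modulo CDT -/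

/-- **The frame crux `ManinGoodOddFrameAdditive` (stmt-BirchSwinnertonDyer-20136) ⟸ CDT**: at every additive `p ≥ 5` with
`E[p]` irreducible and `r_an = 1` a Manin-good odd Hoffstein–Luo frame exists — the datum with `p ∤ c` from §1 (modularity and
Hoffstein–Luo are conjuncts of the decl's own binder `PublishedInputsAdditiveKoly`), then the road's landed
`ManinFrameFromDatum.exists_oddHeegnerFrame_of_exists_not_dvd`. CONDITIONAL on `hCDT`; the item is not closed by this; BSD is
not proved by this. [cite: CalegariDimitrovTang2025, Thm. 1 and Remarks 58–59] [cite: HoffsteinLuo1997, Thm.] -/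
theorem maninGoodOddFrameAdditive_of_CDT
    (hCDT : Literature.NumberTheory.Automorphic.CalegariDimitrovTang2025_unboundedDenominators_algInt) :
    ManinGoodOddFrameAdditive := by
  intro hPub W _ _ p _ _ hp5 hadd hirr hr
  have hp2 : p ≠ 2 := by omega
  exact ManinFrameFromDatum.exists_oddHeegnerFrame_of_exists_not_dvd hPub.2.2.2.2.2.1 hPub.2.2.2.2.2.2.1 W p hr hp2
    (exists_datum_not_dvd_c_of_CDT hCDT hPub.2.2.2.2.2.1 W p hp5 hadd hirr)

/-- **The residue class `ManinFrameResidueClass` (stmt-BirchSwinnertonDyer-20094) ⟸ CDT** (its Edixhoven-exception / `Iₙ*`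
clause is idle). CONDITIONAL; the item is not closed by this; BSD is not proved by this. [cite: CalegariDimitrovTang2025, Thm. 1 and Remarks 58–59] -/
theorem maninFrameResidueClass_of_CDT
    (hCDT : Literature.NumberTheory.Automorphic.CalegariDimitrovTang2025_unboundedDenominators_algInt) :
    ManinFrameResidueClass := by
  intro hPub W _ _ p _ _ hp5 hadd hirr _hcl hr
  exact maninGoodOddFrameAdditive_of_CDT hCDT hPub W p hp5 hadd hirr hr

/-- **The proper residue `ManinFrameResidueProper` (stmt-BirchSwinnertonDyer-20483) ⟸ CDT** (class clause and the
«every degree divisible by `p`» clause idle). CONDITIONAL; the item is not closed by this; BSD is not proved by this.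
[cite: CalegariDimitrovTang2025, Thm. 1 and Remarks 58–59] -/
theorem maninFrameResidueProper_of_CDT
    (hCDT : Literature.NumberTheory.Automorphic.CalegariDimitrovTang2025_unboundedDenominators_algInt) :
    ManinFrameResidueProper := by
  intro hPub W _ _ p _ _ hp5 hadd hirr _hcl _hall hr
  exact maninGoodOddFrameAdditive_of_CDT hCDT hPub W p hp5 hadd hirr hr

/-- **The proper residue GRANTED its printed antecedents, `ManinFrameResidueProperR` (stmt-BirchSwinnertonDyer-20709, the crux
R consumed by the `closes` of AdditiveKolyvaginRoad, TeichmullerTwistDescent and EdixhovenFibreFiveSeven) ⟸ CDT** (Edixhoven /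
Dokchitser antecedents and both residue clauses idle). CONDITIONAL; the item is not closed by this; BSD is not proved by this.
[cite: CalegariDimitrovTang2025, Thm. 1 and Remarks 58–59] -/
theorem maninFrameResidueProperR_of_CDT
    (hCDT : Literature.NumberTheory.Automorphic.CalegariDimitrovTang2025_unboundedDenominators_algInt) :
    ManinFrameResidueProperR := by
  intro _e1 _e2 _dd hPub W _ _ p _ _ hp5 hadd hirr _hcl _hall hr
  exact maninGoodOddFrameAdditive_of_CDT hCDT hPub W p hp5 hadd hirr hr

/-! ### §3 The rung W-ALL/2 modulo CDT and the Kolyvagin-side items -/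

/-- **The rung `WAllExclAdditive` (W-ALL/2) ⟸ CDT ∧ the four Kolyvagin-side open cruxes `KolyvaginPrimitiveAdditive` (21400),
`RankZeroAdditive` (20133), `OffSharpRankOneAdditive` (20134), `AdditiveAtThree` (20135) ∧ the hypothesis-only bundle
`PublishedInputsAdditiveKoly` (20137)** — through the landed assembly (20139) with the frame from §2 and the landed kernel (20138).
None of the ten Manin-side hypotheses of the road's `closes` (Edixhoven ×2, Dokchitser, Mazur, Abbes–Ullmo, Česnavičius, the
two class theorems, the resplit glue, ČNS, the degree class, R) is a hypothesis here. CONDITIONAL; no item is closed by this; BSD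
is not proved and no W-ALL class theorem is proved by this. [cite: CalegariDimitrovTang2025, Thm. 1 and Remarks 58–59]
[cite: WZhang2014, Thm. 1.1] -/
theorem wAllExclAdditive_of_koly_of_CDT
    (hCDT : Literature.NumberTheory.Automorphic.CalegariDimitrovTang2025_unboundedDenominators_algInt)
    (h₁ : KolyvaginPrimitiveAdditive) (h₀ : RankZeroAdditive) (hoff : OffSharpRankOneAdditive) (h₃ : AdditiveAtThree)
    (hP : PublishedInputsAdditiveKoly) :
    Summit.BirchSwinnertonDyer.WAllExclAdditive :=
  AdditiveKoly.assembly h₁ h₀ hoff h₃ (maninGoodOddFrameAdditive_of_CDT hCDT) hP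
    AdditiveKolyvaginKernel.additiveKolyvaginKernel_proof

/-- **The rung W-ALL/2.p>=5.r1 `WAllExclAdditiveFiveLeRankOne` (the leaf of TeichmullerTwistDescent / EdixhovenFibreFiveSeven)
⟸ CDT ∧ the three Kolyvagin-side cruxes (21400, 20133, 20134) ∧ the bundle 20137** — stated with this road's decls (the sibling
routes' homonymous decls are definitionally the same items): ♯-slice by the landed kernel fed with the frame from §2, off-♯ slice =
the item, glued by `wAllExclAdditiveFiveLeRankOne_of_sharp_of_offSharp`. No `PublishedManinFacts`, no `KatoNeronAndCremonaFacts`.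
CONDITIONAL; no item is closed by this; BSD is not proved by this. [cite: CalegariDimitrovTang2025, Thm. 1 and Remarks 58–59]
[cite: WZhang2014, Thm. 1.1] -/
theorem wAllExclAdditiveFiveLeRankOne_of_koly_of_CDT
    (hCDT : Literature.NumberTheory.Automorphic.CalegariDimitrovTang2025_unboundedDenominators_algInt)
    (h₁ : KolyvaginPrimitiveAdditive) (h₀ : RankZeroAdditive) (hoff : OffSharpRankOneAdditive)
    (hP : PublishedInputsAdditiveKoly) :
    Summit.BirchSwinnertonDyer.WAllExclAdditiveFiveLeRankOne := by
  have hSharp : Summit.BirchSwinnertonDyer.WAllExclAdditiveFiveLeRankOneSharp :=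
    fun W _ _ p _ hCM hp5 hadd hr1 hs hsp htwo htam =>
      AdditiveKolyvaginKernel.additiveKolyvaginKernel_proof hP (maninGoodOddFrameAdditive_of_CDT hCDT) h₁ h₀
        W p hCM hp5 hadd hr1 hs hsp htwo htam
  exact Summit.BirchSwinnertonDyer.wAllExclAdditiveFiveLeRankOne_of_sharp_of_offSharp hSharp hoff

end Summit.BirchSwinnertonDyer.BirchSwinnertonDyer.Theorems.AdditiveKolyOfCDT

end
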